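import Summits.AtomisticToContinuum.HydrodynamicLimit.Theorems.AnnealedZeroHorizonMeanFluxClosureIdealEnergyCurrentClosure
import Summits.AtomisticToContinuum.HydrodynamicLimit.Theorems.AnnealedZeroHorizonMeanFluxClosureIdealEnergyCurrentClosureB
import HarnessLib

/-!
# Crux `MeanFluxClosure` (stmt-AtomisticToContinuum-9256), line `registered` — stub KE-b
# (ideal energy-current / heat-flux closure), part 4: the exact reduction of the stub to (D1)

Support file (`--supports stmt-AtomisticToContinuum-9256`) for the stub `stub_idealEnergyCurrentClosure`
(KE-b), continuing parts 1–3. The registered sub-goal `stub_idealEnergyCurrentClosure_of_heatFluxClosure`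
is the GLUE `(D1) → stub_idealEnergyCurrentClosure` (both written verbatim): the stub follows from the
annealed closure of the scale-`ℓ` heat flux plus the velocity-weighted peculiar-stress deviator,
`∀ᶠ N, |E ∫_{t₁}^{t₂}∫_x Σ_i (Σ_j Dev_ij Mv_j/R + q_i) ∂_iψ dx ds| ≤ ε` (same quantifier prefix as the stub;
`Dev`, `q` as in `stub_idealEnergyCurrentClosure_identity`). Ingredients: the pointwise identity
(part 1) integrates to the window identity `∫T^e ds − ∫J^e ds = ∫∫ (Dev u + q)·∇ψ` along every good
orbit (`window_current_sub_idealCurrent_eq`: both integrands are integrable in `x`,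
`integrable_currentIntegrand`/`integrable_idealCurrentIntegrand`, and both observables are interval
integrable in time along good orbits, being measurable and dominated by the conserved moment functional,
`intervalIntegrable_comp_flow_of_abs_le_moment`), the good set is conull, and the `Integrable`
conjunct is part 2 (`stub_idealEnergyCurrentClosure_integrable`, `σ ≤ 1/2`). So after this file the
stub KE-b is EXACTLY (D1): local equilibrium in mean along the deterministic dynamics at the level of
odd third moments of the peculiar velocities — no theorem in print (Olla–Varadhan–Yau 1993 §1 modify the
kinetic energy to avoid it; Nachtergaele–Yau 2003 assume it). No definitions.
-/

noncomputable section

namespace Summit.AtomisticToContinuum.HydrodynamicLimit.Theorems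

open scoped BigOperators ENNReal Topology InnerProductSpace
open MeasureTheory Set Filter
open Literature.Analysis.FluidPDE Literature.Analysis.FunctionSpaces
open Literature.MathematicalPhysics.KineticTheory

namespace IdealEnergyCurrentClosure

open DeviatoricStressClosure

/-! ### Integrability in the base point and in time -/

/-- The mollified energy-current integrand is integrable over the torus (continuous in `x`). [folklore] -/
theorem integrable_currentIntegrand {n : ℕ} (w : Config n (Fin 3) T3) {k : T3 → ℝ} (hkc : Continuous k)
    {ψ : T3 → ℝ} (hψ : Torus.IsSmooth ψ) (c : ℝ) :
    Integrable (fun x : T3 => c * ∑ a, k (x - (w a).1) *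
      ((∑ i, (w a).2 i * Torus.partialDeriv i ψ x) * (‖(w a).2‖ ^ 2 / 2))) :=
  integrable_of_continuous_T3 ((continuous_currentIntegrand_prod (n := n) hkc hψ c).comp
    (continuous_const.prodMk continuous_id))

/-- The ideal enthalpy-flux integrand is integrable over the torus (measurable in `x`, dominated by a
multiple of the continuous mollified density, `abs_idealCurrentIntegrand_le`). [folklore] -/
theorem integrable_idealCurrentIntegrand {n : ℕ} (w : Config n (Fin 3) T3) {k : T3 → ℝ} (hkc : Continuous k)
    (hk0 : ∀ y, 0 ≤ k y) {ψ : T3 → ℝ} (hψ : Torus.IsSmooth ψ) :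
    Integrable (fun x : T3 => (empiricalEnergyField w (fun y => k (x - y)) + empiricalDensityField w (fun y => k (x - y)) * (2 / 3
      * (empiricalEnergyField w (fun y => k (x - y)) / empiricalDensityField w (fun y => k (x - y)) -
      ‖empiricalMomentumField w (fun y => k (x - y))‖ ^ 2 / (2 * empiricalDensityField w (fun y => k (x -
      y)) ^ 2)))) / empiricalDensityField w (fun y => k (x - y)) * (∑ i, empiricalMomentumField w (fun y
      => k (x - y)) i * Torus.partialDeriv i ψ x)) := by
  obtain ⟨C, -, hC⟩ := exists_forall_abs_partialDeriv_le_scalar hψ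
  set M : ℝ := (∑ b, ‖(w b).2‖ ^ 2) + (∑ b, ‖(w b).2‖ ^ 2) ^ 2 with hM
  have hg : Integrable (fun x : T3 => 5 / 4 * C * M * ((n : ℝ)⁻¹ * ∑ a, k (x - (w a).1))) :=
    integrable_of_continuous_T3 (continuous_const.mul (continuous_const.mul
      (continuous_finsetSum _ fun a _ => hkc.comp (continuous_id.sub continuous_const))))
  have hwx : Continuous fun x : T3 => ((w, x) : Config n (Fin 3) T3 × T3) := continuous_const.prodMk continuous_id
  have mR : Measurable fun x : T3 => empiricalDensityField w (fun y => k (x - y)) :=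
    ((continuous_density_prod (n := n) hkc).comp hwx).measurable
  have hMv := (continuous_momentum_prod (n := n) hkc).comp hwx
  have mMv : ∀ l, Measurable fun x : T3 => empiricalMomentumField w (fun y => k (x - y)) l :=
    fun l => ((PiLp.continuous_apply 2 _ l).comp hMv).measurable
  have mN := (continuous_norm.comp hMv).measurable
  have mEn : Measurable fun x : T3 => empiricalEnergyField w (fun y => k (x - y)) :=
    ((continuous_energy_prod (n := n) hkc).comp hwx).measurable
  have mP : ∀ i, Measurable (Torus.partialDeriv i ψ) := fun i => (hψ.partialDeriv i).continuous.measurable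
  have hm : Measurable fun x : T3 => (empiricalEnergyField w (fun y => k (x - y)) + empiricalDensityField w (fun y => k (x - y)) * (2 / 3
      * (empiricalEnergyField w (fun y => k (x - y)) / empiricalDensityField w (fun y => k (x - y)) -
      ‖empiricalMomentumField w (fun y => k (x - y))‖ ^ 2 / (2 * empiricalDensityField w (fun y => k (x -
      y)) ^ 2)))) / empiricalDensityField w (fun y => k (x - y)) * (∑ i, empiricalMomentumField w (fun y
      => k (x - y)) i * Torus.partialDeriv i ψ x) :=
    ((mEn.add (mR.mul (measurable_const.mul ((mEn.div mR).sub ((mN.pow_const 2).div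
      (measurable_const.mul (mR.pow_const 2))))))).div mR).mul (Finset.measurable_sum _ fun i _ => (mMv i).mul (mP i))
  refine hg.mono' hm.aestronglyMeasurable (ae_of_all _ fun x => ?_)
  rw [Real.norm_eq_abs]
  exact abs_idealCurrentIntegrand_le w x hk0 hC rfl rfl rfl

/-- **Moment-dominated measurable observables are interval integrable along good orbits**: the orbit is
measurable in time (`IsHardSphereTrajectory.measurable_torus`) and `M(Φ_s z) = M(z)` (energy
conservation). [folklore] -/
theorem intervalIntegrable_comp_flow_of_abs_le_moment {n : ℕ} {ε : ℝ}
    (Φ : HardSphereFlow (Torus.geometry (Fin 3)) ε n) {z : Config n (Fin 3) T3} (hz : z ∈ Φ.good)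
    {G : Config n (Fin 3) T3 → ℝ} (hGm : Measurable G) {K : ℝ}
    (hGle : ∀ w, |G w| ≤ K * ((∑ b, ‖(w b).2‖ ^ 2) + (∑ b, ‖(w b).2‖ ^ 2) ^ 2)) (a b : ℝ) :
    IntervalIntegrable (fun s => G (Φ.flow s z)) volume a b := by
  have hm : Measurable fun s => G (Φ.flow s z) := hGm.comp (Φ.isTrajectory z hz).measurable_torus
  exact (intervalIntegrable_const (c := K * ((∑ b, ‖(z b).2‖ ^ 2) + (∑ b, ‖(z b).2‖ ^ 2) ^ 2))).mono_fun'
    hm.aestronglyMeasurable (ae_of_all _ fun s => by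
      dsimp only
      rw [Real.norm_eq_abs, ← sum_norm_sq_vel_flow Φ hz s]
      exact hGle _)

/-! ### The window identity along a good orbit -/

/-- **The space-integrated identity**: for every configuration, `T^e(w) − J^e(w) = ∫_x (Dev u + q)·∇ψ dx`
(`stub_idealEnergyCurrentClosure_identity` under `∫_x`, both integrands being integrable). [folklore] -/
theorem integral_current_sub_idealCurrent_eq {n : ℕ} (w : Config n (Fin 3) T3) {k : T3 → ℝ}
    (hkc : Continuous k) (hk0 : ∀ y, 0 ≤ k y) {ψ : T3 → ℝ} (hψ : Torus.IsSmooth ψ) :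
    (∫ x, (n : ℝ)⁻¹ * ∑ a, k (x - (w a).1) * ((∑ i, (w a).2 i * Torus.partialDeriv i ψ x) * (‖(w a).2‖ ^ 2 /
      2))) - (∫ x, (empiricalEnergyField w (fun y => k (x - y)) + empiricalDensityField w (fun y => k (x - y)) * (2 / 3
      * (empiricalEnergyField w (fun y => k (x - y)) / empiricalDensityField w (fun y => k (x - y)) -
      ‖empiricalMomentumField w (fun y => k (x - y))‖ ^ 2 / (2 * empiricalDensityField w (fun y => k (x -
      y)) ^ 2)))) / empiricalDensityField w (fun y => k (x - y)) * (∑ i, empiricalMomentumField w (fun y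
      => k (x - y)) i * Torus.partialDeriv i ψ x)) = ∫ x, ∑ i, ((∑ j, ((n : ℝ)⁻¹ * ∑ a, k (x - (w a).1) * (((w a).2 i - empiricalMomentumField w (fun y => k
      (x - y)) i / empiricalDensityField w (fun y => k (x - y))) * ((w a).2 j - empiricalMomentumField w
      (fun y => k (x - y)) j / empiricalDensityField w (fun y => k (x - y)))) - (if i = j then 1 else 0) *
      ((∑ l, (n : ℝ)⁻¹ * ∑ a, k (x - (w a).1) * (((w a).2 l - empiricalMomentumField w (fun y => k (x -
      y)) l / empiricalDensityField w (fun y => k (x - y))) * ((w a).2 l - empiricalMomentumField w (fun y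
      => k (x - y)) l / empiricalDensityField w (fun y => k (x - y))))) / 3)) * (empiricalMomentumField w
      (fun y => k (x - y)) j / empiricalDensityField w (fun y => k (x - y)))) + (n : ℝ)⁻¹ * ∑ a, k (x - (w
      a).1) * (((w a).2 i - empiricalMomentumField w (fun y => k (x - y)) i / empiricalDensityField w (fun
      y => k (x - y))) * ((∑ l, ((w a).2 l - empiricalMomentumField w (fun y => k (x - y)) l /
      empiricalDensityField w (fun y => k (x - y))) ^ 2) / 2))) * Torus.partialDeriv i ψ x := by
  rw [← integral_sub (integrable_currentIntegrand w hkc hψ _) (integrable_idealCurrentIntegrand w hkc hk0 hψ)]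
  exact integral_congr_ae (ae_of_all _ fun x => stub_idealEnergyCurrentClosure_identity n w x k hk0 ψ)

/-- **The window identity along a good orbit**: `∫_{t₁}^{t₂} T^e(Φ_s z) ds − ∫_{t₁}^{t₂} J^e(Φ_s z) ds =
∫_{t₁}^{t₂} ∫_x (Dev u + q)·∇ψ dx ds` (both observables are interval integrable in time: measurable,
`measurable_currentObservable`/`measurable_idealCurrentObservable`, and dominated by the conserved moment
functional, `abs_integral_currentIntegrand_le`/`abs_integral_idealCurrentIntegrand_le`). [folklore] -/
theorem window_current_sub_idealCurrent_eq {n : ℕ} {ε : ℝ} (Φ : HardSphereFlow (Torus.geometry (Fin 3)) ε n)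
    {z : Config n (Fin 3) T3} (hz : z ∈ Φ.good) {k : T3 → ℝ} (hkc : Continuous k) (hk0 : ∀ y, 0 ≤ k y)
    (hk1 : ∫ y, k y = 1) {ψ : T3 → ℝ} (hψ : Torus.IsSmooth ψ) (t₁ t₂ : ℝ) :
    (∫ s in t₁..t₂, ∫ x, (n : ℝ)⁻¹ * ∑ a, k (x - (Φ.flow s z a).1) * ((∑ i, (Φ.flow s z a).2 i * Torus.partialDeriv i ψ x) *
        (‖(Φ.flow s z a).2‖ ^ 2 / 2))) -
        (∫ s in t₁..t₂, ∫ x, (empiricalEnergyField (Φ.flow s z) (fun y => k (x - y)) + empiricalDensityField (Φ.flow s z) (fun y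
          => k (x - y)) * (2 / 3 * (empiricalEnergyField (Φ.flow s z) (fun y => k (x - y)) /
          empiricalDensityField (Φ.flow s z) (fun y => k (x - y)) - ‖empiricalMomentumField (Φ.flow s z) (fun
          y => k (x - y))‖ ^ 2 / (2 * empiricalDensityField (Φ.flow s z) (fun y => k (x - y)) ^ 2)))) /
          empiricalDensityField (Φ.flow s z) (fun y => k (x - y)) * (∑ i, empiricalMomentumField (Φ.flow s z)
          (fun y => k (x - y)) i * Torus.partialDeriv i ψ x)) =
      ∫ s in t₁..t₂, ∫ x, ∑ i, ((∑ j, ((n : ℝ)⁻¹ * ∑ a, k (x - (Φ.flow s z a).1) * (((Φ.flow s z a).2 i -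
        empiricalMomentumField (Φ.flow s z) (fun y => k (x - y)) i / empiricalDensityField (Φ.flow s z) (fun
        y => k (x - y))) * ((Φ.flow s z a).2 j - empiricalMomentumField (Φ.flow s z) (fun y => k (x - y)) j
        / empiricalDensityField (Φ.flow s z) (fun y => k (x - y)))) - (if i = j then 1 else 0) * ((∑ l, (n :
        ℝ)⁻¹ * ∑ a, k (x - (Φ.flow s z a).1) * (((Φ.flow s z a).2 l - empiricalMomentumField (Φ.flow s z)
        (fun y => k (x - y)) l / empiricalDensityField (Φ.flow s z) (fun y => k (x - y))) * ((Φ.flow s z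
        a).2 l - empiricalMomentumField (Φ.flow s z) (fun y => k (x - y)) l / empiricalDensityField (Φ.flow
        s z) (fun y => k (x - y))))) / 3)) * (empiricalMomentumField (Φ.flow s z) (fun y => k (x - y)) j /
        empiricalDensityField (Φ.flow s z) (fun y => k (x - y)))) + (n : ℝ)⁻¹ * ∑ a, k (x - (Φ.flow s z
        a).1) * (((Φ.flow s z a).2 i - empiricalMomentumField (Φ.flow s z) (fun y => k (x - y)) i /
        empiricalDensityField (Φ.flow s z) (fun y => k (x - y))) * ((∑ l, ((Φ.flow s z a).2 l -
        empiricalMomentumField (Φ.flow s z) (fun y => k (x - y)) l / empiricalDensityField (Φ.flow s z) (fun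
        y => k (x - y))) ^ 2) / 2))) * Torus.partialDeriv i ψ x := by
  obtain ⟨C, -, hC⟩ := exists_forall_abs_partialDeriv_le_scalar hψ
  have hTi := intervalIntegrable_comp_flow_of_abs_le_moment Φ hz (measurable_currentObservable hkc hψ ((n : ℝ)⁻¹))
    (fun w => abs_integral_currentIntegrand_le w hkc hk0 hk1 hC) t₁ t₂
  have hJi := intervalIntegrable_comp_flow_of_abs_le_moment Φ hz (measurable_idealCurrentObservable hkc hψ)
    (fun w => abs_integral_idealCurrentIntegrand_le w hkc hk0 hk1 hC) t₁ t₂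
  rw [← intervalIntegral.integral_sub hTi hJi]
  exact intervalIntegral.integral_congr fun s _ => integral_current_sub_idealCurrent_eq (Φ.flow s z) hkc hk0 hψ

end IdealEnergyCurrentClosure

open IdealEnergyCurrentClosure DeviatoricStressClosure in
/-- **Registered sub-goal `stub_idealEnergyCurrentClosure_of_heatFluxClosure`: stub KE-b follows from (D1).**
If, for all continuous positive profiles, small `σ`, every flow family, window `0 ≤ t₁ ≤ t₂`, `ε > 0` and
smooth `ψ` there is `ℓ > 0` such that for every continuous probability kernel `k ≥ 0` supported in the
`ℓ`-ball, eventually in `N`,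
`|E ∫_{t₁}^{t₂}∫_x Σ_i (Σ_j (P_ij − δ_ij tr P/3) Mv_j/R + q_i) ∂_iψ dx ds| ≤ ε`
(annealed vanishing of the scale-`ℓ` heat flux `q` and of the work of the peculiar-stress deviator along
the hard-sphere dynamics under the local Gibbs law — hypothesis (D1), written out), then
`stub_idealEnergyCurrentClosure` holds (verbatim): with `σ₀ := min σ₀' ½`, the `Integrable` conjunct is
`stub_idealEnergyCurrentClosure_integrable` and, almost surely (good set), the stub's functional equals the
(D1) functional by the window identity `window_current_sub_idealCurrent_eq`. [folklore] -/
theorem stub_idealEnergyCurrentClosure_of_heatFluxClosure : (∀ (a₀ θ₀ : T3 → ℝ) (u₀ : T3 → V3), Continuous a₀ → Continuous θ₀ → Continuous u₀ → (∀ x, 0 < a₀ x) → (∀ x, 0 < θ₀ x) → ∃ σ₀ : ℝ, 0 < σ₀ ∧ ∀ σ : ℝ, 0 < σ → σ < σ₀ → ∀ Φ : (N : ℕ) → HardSphereFlow (Torus.geometry (Fin 3)) (hsDiameter σ N) (N + 1), ∀ t₁ t₂ : ℝ, 0 ≤ t₁ → t₁ ≤ t₂ → ∀ ε : ℝ, 0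 < ε → (∀ ψ : T3 → ℝ, Torus.IsSmooth ψ → ∃ ℓ : ℝ, 0 < ℓ ∧ ∀ k : T3 → ℝ, (Continuous k ∧ (∀ y, 0 ≤ k y) ∧ (∫ y, k y = 1) ∧ (∀ y, k y ≠ 0 → Torus.euclidDist y 0 < ℓ)) → ∀ᶠ N in Filter.atTop, |∫ z, (∫ s in t₁..t₂, ∫ x, ∑ i, ((∑ j, (((N + 1 : ℕ) : ℝ)⁻¹ * ∑ a, k (x - ((Φ N).flow s z a).1) * ((((Φ N).flow s z a).2 i - empiricalMomentumField ((Φ N).flow s z) (fun y => k (x - y)) i / empiricalDensityField ((Φ N).flow s z) (fun y => k (x - y))) * (((Φ N).flow s z a).2 j - empiricalMomentumField ((Φ N).flow s z) (fun y => k (x - y)) j / empiricalDensityField ((Φ N).flow s z) (fun y => k (x - y)))) - (if i = j then 1 else 0) * ((∑ l, ((N + 1 : ℕ) : ℝ)⁻¹ * ∑ a, k (x - ((Φ N).flow s z a).1) * ((((Φ N).flow s z a).2 l - empiricalMomentumField ((Φ N).flow s z) (fun y => k (x - y)) l / empiricalDensityField ((Φ N).flow s z) (fun y => k (x - y))) *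 (((Φ N).flow s z a).2 l - empiricalMomentumField ((Φ N).flow s z) (fun y => k (x - y)) l / empiricalDensityField ((Φ N).flow s z) (fun y => k (x - y))))) / 3)) * (empiricalMomentumField ((Φ N).flow s z) (fun y => k (x - y)) j / empiricalDensityField ((Φ N).flow s z) (fun y => k (x - y)))) + ((N + 1 : ℕ) : ℝ)⁻¹ * ∑ a, k (x - ((Φ N).flow s z a).1) * ((((Φ N).flow s z a).2 i - empiricalMomentumField ((Φ N).flow s z) (fun y => k (x - y)) i / empiricalDensityField ((Φ N).flow s z) (fun y => k (x - y))) * ((∑ l, (((Φ N).flow s z a).2 l - empiricalMomentumField ((Φ N).flow s z) (fun y => k (x - y)) l / empiricalDensityField ((Φ N).flow s z) (fun y => k (x - y))) ^ 2) / 2))) * Torus.partialDeriv i ψ x) ∂localGibbsLaw σ a₀ u₀ θ₀ N (Φ N)| ≤ ε)) → ∀ (a₀ θ₀ : T3 → ℝ) (u₀ : T3 → V3), Continuous a₀ → Continuous θ₀ → Continuous u₀ → (∀ x, 0 < a₀ x) → (∀ x, 0 < θ₀ x) → ∃ σ₀ : ℝ, 0 < σ₀ ∧ ∀ σ : ℝ,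 0 < σ → σ < σ₀ → ∀ Φ : (N : ℕ) → HardSphereFlow (Torus.geometry (Fin 3)) (hsDiameter σ N) (N + 1), ∀ t₁ t₂ : ℝ, 0 ≤ t₁ → t₁ ≤ t₂ → ∀ ε : ℝ, 0 < ε → (∀ ψ : T3 → ℝ, Torus.IsSmooth ψ → ∃ ℓ : ℝ, 0 < ℓ ∧ ∀ k : T3 → ℝ, (Continuous k ∧ (∀ y, 0 ≤ k y) ∧ (∫ y, k y = 1) ∧ (∀ y, k y ≠ 0 → Torus.euclidDist y 0 < ℓ)) → ∀ᶠ N in Filter.atTop, ∀ D : Config (N + 1) (Fin 3) T3 → ℝ, D = (fun z => (∫ s in t₁..t₂, ∫ x, ((N + 1 : ℕ) : ℝ)⁻¹ * ∑ a, k (x - ((Φ N).flow s z a).1) * ((∑ i, ((Φ N).flow s z a).2 i * Torus.partialDeriv i ψ x) * (‖((Φ N).flow s z a).2‖ ^ 2 / 2))) - (∫ s in t₁..t₂, ∫ x, (((empiricalEnergyField ((Φ N).flow s z) (fun y => k (x - y)) + empiricalDensityField ((Φ N).flow s z) (fun y => k (x - y)) * (2 / 3 * (empiricalEnergyField ((Φ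 N).flow s z) (fun y => k (x - y)) / empiricalDensityField ((Φ N).flow s z) (fun y => k (x - y)) - ‖empiricalMomentumField ((Φ N).flow s z) (fun y => k (x - y))‖ ^ 2 / (2 * empiricalDensityField ((Φ N).flow s z) (fun y => k (x - y)) ^ 2)))) / empiricalDensityField ((Φ N).flow s z) (fun y => k (x - y))) * (∑ i, empiricalMomentumField ((Φ N).flow s z) (fun y => k (x - y)) i * Torus.partialDeriv i ψ x)))) → MeasureTheory.Integrable D (localGibbsLaw σ a₀ u₀ θ₀ N (Φ N)) ∧ |∫ z, D z ∂localGibbsLaw σ a₀ u₀ θ₀ N (Φ N)| ≤ ε) := by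
  intro hD1 a₀ θ₀ u₀ ha hθ hu ha0 hθ0
  obtain ⟨σ₀, hσ₀, H⟩ := hD1 a₀ θ₀ u₀ ha hθ hu ha0 hθ0
  refine ⟨min σ₀ (1 / 2), lt_min hσ₀ one_half_pos, ?_⟩
  intro σ hσ hσlt Φ t₁ t₂ h₁ h₁₂ ε hε ψ hψ
  obtain ⟨ℓ, hℓ, Hk⟩ := H σ hσ (hσlt.trans_le (min_le_left _ _)) Φ t₁ t₂ h₁ h₁₂ ε hε ψ hψ
  refine ⟨ℓ, hℓ, fun k hk => ?_⟩
  filter_upwards [Hk k hk] with N hN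
  intro D hD
  have hσ2 : σ ≤ 1 / 2 := (hσlt.trans_le (min_le_right _ _)).le
  refine ⟨stub_idealEnergyCurrentClosure_integrable σ hσ2 a₀ θ₀ u₀ ha hθ hu ha0 hθ0 N (Φ N) t₁ t₂ ψ hψ k
    hk.1 hk.2.1 hk.2.2.1 D hD, ?_⟩
  have hae : ∀ᵐ z ∂(localGibbsLaw σ a₀ u₀ θ₀ N (Φ N)), D z =
      ∫ s in t₁..t₂, ∫ x, ∑ i, ((∑ j, (((N + 1 : ℕ) : ℝ)⁻¹ * ∑ a, k (x - ((Φ N).flow s z a).1) * ((((Φ N).flow s z a).2 i -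
        empiricalMomentumField ((Φ N).flow s z) (fun y => k (x - y)) i / empiricalDensityField ((Φ N).flow s
        z) (fun y => k (x - y))) * (((Φ N).flow s z a).2 j - empiricalMomentumField ((Φ N).flow s z) (fun y
        => k (x - y)) j / empiricalDensityField ((Φ N).flow s z) (fun y => k (x - y)))) - (if i = j then 1
        else 0) * ((∑ l, ((N + 1 : ℕ) : ℝ)⁻¹ * ∑ a, k (x - ((Φ N).flow s z a).1) * ((((Φ N).flow s z a).2 l
        - empiricalMomentumField ((Φ N).flow s z) (fun y => k (x - y)) l / empiricalDensityField ((Φ N).flow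
        s z) (fun y => k (x - y))) * (((Φ N).flow s z a).2 l - empiricalMomentumField ((Φ N).flow s z) (fun
        y => k (x - y)) l / empiricalDensityField ((Φ N).flow s z) (fun y => k (x - y))))) / 3)) *
        (empiricalMomentumField ((Φ N).flow s z) (fun y => k (x - y)) j / empiricalDensityField ((Φ N).flow
        s z) (fun y => k (x - y)))) + ((N + 1 : ℕ) : ℝ)⁻¹ * ∑ a, k (x - ((Φ N).flow s z a).1) * ((((Φ
        N).flow s z a).2 i - empiricalMomentumField ((Φ N).flow s z) (fun y => k (x - y)) i /
        empiricalDensityField ((Φ N).flow s z) (fun y => k (x - y))) * ((∑ l, (((Φ N).flow s z a).2 l -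
        empiricalMomentumField ((Φ N).flow s z) (fun y => k (x - y)) l / empiricalDensityField ((Φ N).flow s
        z) (fun y => k (x - y))) ^ 2) / 2))) * Torus.partialDeriv i ψ x := by
    filter_upwards [(ae_mem_good_localGibbsLaw σ a₀ u₀ θ₀ N (Φ N)).1] with z hz
    rw [hD]
    exact window_current_sub_idealCurrent_eq (Φ N) hz hk.1 hk.2.1 hk.2.2.1 hψ t₁ t₂
  rw [integral_congr_ae hae]
  exact hN

end Summit.AtomisticToContinuum.HydrodynamicLimit.Theorems

end
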